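import Mathlib
import HarnessLib
import Summits.ValiantsHypothesis.ValiantsHypothesis.Theorems.LacunarySymmetroidMatrixDescartesReshapingGenericHankel

/-!
# K1 + K1′ PROVED (card `reshaping-generic`, val-idea-23 g2, ideation (d) REFUTE side of V1 `MatrixDescartes`)

LANDING-READY STAGING of crux workfile `Cruxes/MatrixDescartes/ReshapingGenericK1Proof.lean` rev 4 (tree conventions per crit-6
VERDICT #17: `import HarnessLib`, `dupNamespace` off, Theorems namespace); intended target
`Theorems/LacunarySymmetroidMatrixDescartesReshapingGeneric.lean --supports stmt-ValiantsHypothesis-18050 --as helper` (a PROVER files it;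
this seat is publish-only).

rev 3 (2026-08-28): adds Part D′ — the card's **K1′ `SpreadHankelGeneric`** (`spreadHankelGeneric`,
`K1Check.spreadHankelGeneric_holds`): for `q > 1`, `f` strongly `q`-log-concave (signed form: `f k ≠ 0`,
`q·|f k|·|f (k+2)| ≤ f (k+1)²`), row labels `a : Fin r → ℕ` and column labels `b : Fin c → ℕ` strictly increasing
and `s`-separated, `r ≤ c` and `4·r ≤ q^{s·s}` ⇒ the generalized-Hankel cut `(i, j) ↦ f (a i + b j)` has full row rank
`r` (gap `s²·log q` per inversion; `θ = q^{−s²/2}`, `2·Σ_{1≤j<r} θ^j < 1` from `θ² ≤ 1/(4r)`).  Hence the typed sector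
law `K1Check.TTSectorLaw := ReshapingGeneric ∧ SpreadHankelGeneric` holds (`ttSectorLaw_holds`); Part F proves the support statement
P1 `K1Check.KroneckerDigit` (`kroneckerDigit_holds`, via Mathlib `finFunctionFinEquiv`) — every typed Prop of the sketch is now a theorem.  rev 2: sign-blind K1
(`reshapingGeneric_signed`, critic VERDICT #12 P1).  VP ≠ VNP is not touched by any of this.

`reshapingGeneric` / `K1Check.reshapingGeneric_holds`: for `q ≥ 4` and `f : ℕ → ℝ` strongly `q`-log-concave
(`f > 0`, `q·f(k)·f(k+2) ≤ f(k+1)²` — Hutchinson's hypothesis at `q = 4`), EVERY base-`P` digit reshaping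
`(x, y) ↦ f (P·y + x)` (`x < P`, `y < H`) has full rank `min P H`.  In particular every sequential (tensor-train) cut of
the coefficient tensor of a digit lift `L_f = Σ_e f(Σ e_i B^i) y^e` (theta / q-Pochhammer profiles of the cancellation
door) has full rank `B^{min(t, n-t)}`, so by Nisan's rank bound no ordered ABP / ROABP of width `< B^{⌊n/2⌋}` computes
it — the card's sector law K2 for the ORDERED sector follows (K2's Nisan step is not formalised here).  Nothing here
bears on VP ≠ VNP; it closes one more digit-lift monster family on the cancellation door of V1.

Proof route (0 sorry): A. geometric row sums + Levy–Desplanques (`det_ne_zero_of_sum_row_lt_diag`);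
B. gap-Monge potentials `u, v` turning «row increments grow by ≥ 2L per column» into two-sided decay
`W x i − u x − v i ≤ −L|x−i|`; C. strong log-concavity ⇒ log-ratios drop by `log q` per step ⇒ the log-matrix of any
«increasing rows / 2-spread decreasing columns» minor of `(f (a+b))` is gap-Monge with `L = log q ≥ log 4`;
D. `exp` of the normalised matrix is strictly diagonally dominant ⇒ `det ≠ 0` ⇒ leading `r × r` minor (columns
reversed) of the reshaping is non-singular ⇒ rank `= min P H` (`Matrix.rank_submatrix_le`, `rank_of_isUnit`).

(part 4/4 of the landed split: K1 positive form `reshapingGeneric`, section F `kroneckerDigit_core`, section E `K1Check` — the card's typed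
Props `ReshapingGeneric`, `ReshapingGenericSigned`, `SpreadHankelGeneric`, `TTSectorLaw`, `KroneckerDigit` with their `_holds` witnesses.)

AUTHORSHIP: val-idea-23 g2 (card `reshaping-generic`, crux workfile `Cruxes/MatrixDescartes/ReshapingGenericK1Proof.lean` rev 4,
staged bytes sha12 527413dd06f8); SPLIT into four ≤ 400-line files and landed by val-lit-p7 g14 (landing hand, director R290 (2)(iii) /
desk RULING #329) with no mathematical change: parts `…ReshapingGenericDecay` (A–B), `…ReshapingGenericLogConcave` (C–D),
`…ReshapingGenericHankel` (D′), `…ReshapingGeneric` (K1 positive form, F Kronecker, E K1Check).  VP ≠ VNP is not touched.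
-/

set_option linter.dupNamespace false
set_option autoImplicit false

namespace Summit.ValiantsHypothesis.ValiantsHypothesis.Theorems.LacunarySymmetroidMatrixDescartes.ReshapingGeneric

open Finset Real Matrix


/-- **K1 (positive form, as typed on the card).**  This is literally the statement `ReshapingGeneric` of
`ReshapingGenericSketch.lean` with `IsStrongLogConcave` and `reshape` unfolded. -/
theorem reshapingGeneric : ∀ q : ℝ, 4 ≤ q → ∀ f : ℕ → ℝ,
    ((∀ k, 0 < f k) ∧ ∀ k, q * (f k * f (k + 2)) ≤ f (k + 1) ^ 2) →
    ∀ P H : ℕ, (Matrix.of fun (x : Fin P) (y : Fin H) => f (P * (y : ℕ) + (x : ℕ))).rank = min P H := by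
  intro q hq f hf P H
  refine reshapingGeneric_signed q hq f ⟨fun k => (hf.1 k).ne', fun k => ?_⟩ P H
  rw [abs_of_pos (hf.1 k), abs_of_pos (hf.1 (k + 2))]
  exact hf.2 k

/-! ## F. Kronecker substitution of a digit lift (the card's support statement P1 `KroneckerDigit`) -/

section Kronecker
open Polynomial

/-- `aeval (y_i ↦ X^{c·B^i})` sends the digit lift `Σ_e f(Σ e_i B^i)·Π y_i^{e_i}` to the lacunary one-variable polynomial
`Σ_{k < B^n} f k · X^{c·k}` (base-`B` digits are a bijection `(Fin n → Fin B) ≃ Fin (B^n)`, Mathlib `finFunctionFinEquiv`).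
Holds for every `B` (the card's `2 ≤ B` is not needed). -/
theorem kroneckerDigit_core (B n c : ℕ) (f : ℕ → ℝ) :
    MvPolynomial.aeval (fun i : Fin n => (X : ℝ[X]) ^ (c * B ^ (i : ℕ)))
        (∑ e : Fin n → Fin B, MvPolynomial.C (f (∑ i, (e i : ℕ) * B ^ (i : ℕ))) * ∏ i, MvPolynomial.X i ^ (e i : ℕ))
      = ∑ k ∈ Finset.range (B ^ n), Polynomial.C (f k) * X ^ (c * k) := by
  rw [map_sum]
  have hterm : ∀ e : Fin n → Fin B,
      MvPolynomial.aeval (fun i : Fin n => (X : ℝ[X]) ^ (c * B ^ (i : ℕ)))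
        (MvPolynomial.C (f (∑ i, (e i : ℕ) * B ^ (i : ℕ))) * ∏ i, MvPolynomial.X i ^ (e i : ℕ))
      = Polynomial.C (f (∑ i, (e i : ℕ) * B ^ (i : ℕ))) * X ^ (c * ∑ i, (e i : ℕ) * B ^ (i : ℕ)) := by
    intro e
    rw [map_mul, MvPolynomial.aeval_C, map_prod, Polynomial.algebraMap_eq]
    congr 1
    simp only [map_pow, MvPolynomial.aeval_X, ← pow_mul]
    rw [Finset.prod_pow_eq_pow_sum, Finset.mul_sum]
    congr 1
    apply Finset.sum_congr rfl
    intro i _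
    ring
  simp only [hterm]
  rw [← Fin.sum_univ_eq_sum_range (fun k => Polynomial.C (f k) * X ^ (c * k)) (B ^ n)]
  rw [← Equiv.sum_comp finFunctionFinEquiv]
  apply Fintype.sum_congr
  intro e
  simp

end Kronecker

/-! ## E. Kernel cross-check against the card's typed K1

`ReshapingGenericSketch.lean` (crux workfile @7d6b33672665) is not importable from a workfile check, so its two
definitions and the Prop `ReshapingGeneric` are copied into the sub-namespace `K1Check` (Props verbatim up to
INLINING the predicate `IsStrongLogConcave q f` as its two conjuncts — δ-equal to the sketch's Props; no Prop-valued predicate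
def remains, per crit-6 READ #21, so the file audit has no `vendored-fact` entries); the one-line proof
below confirms that `reshapingGeneric` is literally the card's K1. -/

namespace K1Check

/-- verbatim copy of `reshape` (ReshapingGenericSketch.lean). -/
def reshape (f : ℕ → ℝ) (P H : ℕ) : Matrix (Fin P) (Fin H) ℝ :=
  Matrix.of fun x y => f (P * (y : ℕ) + (x : ℕ))

/-- `ReshapingGeneric` of ReshapingGenericSketch.lean (= the card's K1) with `IsStrongLogConcave` inlined (δ-equal). -/
def ReshapingGeneric : Prop :=
  ∀ q : ℝ, 4 ≤ q → ∀ f : ℕ → ℝ, ((∀ k, 0 < f k) ∧ ∀ k, q * (f k * f (k + 2)) ≤ f (k + 1) ^ 2) →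
    ∀ P H : ℕ, (reshape f P H).rank = min P H

/-- **K1 holds.** -/
theorem reshapingGeneric_holds : ReshapingGeneric :=
  fun q hq f hf P H => reshapingGeneric q hq f hf P H

/-- K1 with arbitrary signs: the typed strengthening asked for in P1. -/
def ReshapingGenericSigned : Prop :=
  ∀ q : ℝ, 4 ≤ q → ∀ f : ℕ → ℝ, ((∀ k, f k ≠ 0) ∧ ∀ k, q * (|f k| * |f (k + 2)|) ≤ f (k + 1) ^ 2) →
    ∀ P H : ℕ, (reshape f P H).rank = min P H

/-- **Signed K1 holds** (same proof: the dominance argument only sees `|f|`). -/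
theorem reshapingGenericSigned_holds : ReshapingGenericSigned :=
  fun q hq f hf P H => reshapingGeneric_signed q hq f hf P H

/-- verbatim copy of `hankelCut` (ReshapingGenericSketch.lean). -/
def hankelCut (f : ℕ → ℝ) {ι κ : Type*} (a : ι → ℕ) (b : κ → ℕ) : Matrix ι κ ℝ :=
  Matrix.of fun i j => f (a i + b j)

/-- `SpreadHankelGeneric` of ReshapingGenericSketch.lean (= the card's K1′) with `IsStrongLogConcave` inlined (δ-equal). -/
def SpreadHankelGeneric : Prop :=
  ∀ q : ℝ, 1 < q → ∀ f : ℕ → ℝ, ((∀ k, 0 < f k) ∧ ∀ k, q * (f k * f (k + 2)) ≤ f (k + 1) ^ 2) →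
    ∀ (r c s : ℕ) (a : Fin r → ℕ) (b : Fin c → ℕ), r ≤ c → StrictMono a → StrictMono b →
      (∀ i j : Fin r, i < j → a i + s ≤ a j) → (∀ i j : Fin c, i < j → b i + s ≤ b j) →
      (4 * r : ℝ) ≤ q ^ (s * s) → (hankelCut f a b).rank = r

/-- **K1′ holds.** -/
theorem spreadHankelGeneric_holds : SpreadHankelGeneric :=
  fun q hq f hf r c s a b hrc ha hb has hbs hr =>
    spreadHankelGeneric q hq f hf r c s a b hrc ha hb has hbs hr

/-- verbatim copy of `TTSectorLaw` (ReshapingGenericSketch.lean): the typed part of the card's sector law. -/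
def TTSectorLaw : Prop := ReshapingGeneric ∧ SpreadHankelGeneric

/-- **The typed sector law holds** (K1 ∧ K1′). -/
theorem ttSectorLaw_holds : TTSectorLaw := ⟨reshapingGeneric_holds, spreadHankelGeneric_holds⟩

section KroneckerCopies
open scoped BigOperators
open Polynomial

/-- verbatim copy of `digitLift` (ReshapingGenericSketch.lean). -/
noncomputable def digitLift (B n : ℕ) (f : ℕ → ℝ) : MvPolynomial (Fin n) ℝ :=
  ∑ e : Fin n → Fin B, MvPolynomial.C (f (∑ i, (e i : ℕ) * B ^ (i : ℕ))) * ∏ i, MvPolynomial.X i ^ (e i : ℕ)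

/-- verbatim copy of `KroneckerDigit` (ReshapingGenericSketch.lean) = the card's support statement P1. -/
def KroneckerDigit : Prop :=
  ∀ (B n c : ℕ) (f : ℕ → ℝ), 2 ≤ B →
    MvPolynomial.aeval (fun i : Fin n => (X : ℝ[X]) ^ (c * B ^ (i : ℕ))) (digitLift B n f)
      = ∑ k ∈ Finset.range (B ^ n), Polynomial.C (f k) * X ^ (c * k)

/-- **P1 holds.** -/
theorem kroneckerDigit_holds : KroneckerDigit := by
  intro B n c f _
  unfold digitLift
  exact kroneckerDigit_core B n c f

end KroneckerCopies

end K1Check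

end Summit.ValiantsHypothesis.ValiantsHypothesis.Theorems.LacunarySymmetroidMatrixDescartes.ReshapingGeneric
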